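import Mathlib
import HarnessLib
import Summits.HubbardSuperconductivity.HubbardSuperconductivity.Theorems.KLProgrammePerturbedFermiCurveGaussMapRate

/-!
# Route `KLProgramme` — ENGINE child (stmt-HubbardSuperconductivity-20437 `KLRegimeEngineV17F2`): the Gauss-map rate of the perturbed Fermi curve
# from a TANGENTIAL-HESSIAN FLOOR — the `κ₂`-FREE (hence frame-uniform) form needed by the `TwoShellFrameAreaAt` witness

Cell `gate-hubbard-kl`, seat hubbard-kl-k3c2-p2 g15; companion of `…PerturbedFermiCurveGaussMapRate` (p603406) and of the design note
HOME/hubbard-kl-k3c2-p2/TWO-SHELL-FRAME-PORT.md.  There the rate `α′ = (u² + 2u′² − uu″)/(u² + u′²)` was bounded below through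
`curvatureNumerator_ge`, whose constant contains `κ₂ = ‖D²δ‖` — NOT uniform in the number `N` of frame pieces that `TwoShellFrameAreaAt` quantifies
over.  Here the second-order input is instead ONE hypothesis in p4's coordinates,
  (H) `w·(X_E′² + Y_E′²) ≤ 2cos X_E·X_E′² + 2cos Y_E·Y_E′² + D²δ(p)[v, v]`  (`p = u·dir θ`, `v = (X_E′, Y_E′)` the tangent),
i.e. the Hessian of `E = ε₀ + δ` along the tangent of its own level curve is `≥ w|v|²` — exactly the field `GeomConstants.le_hessQuad` of `FrameOK` (i)
(`w = 3/200` for `e_K = frameLevel μ K`, K-uniform) read in coordinates.  With p4's curvature identity `(∇E·dir θ)·(u² + 2u′² − uu″) = u·(vᵀD²E v)`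
(`pertDt_mul_curvatureNumerator_eq`) and `0 < ∇E·dir θ ≤ 4 + κ₁`:
* `curvatureNumerator_ge_of_hessFloor` — `u·w·(u′² + u²)/(4 + κ₁) ≤ u² + 2u′² − uu″`;
* **`deriv_normalAngleFn_ge_of_hessFloor`** — `α′(θ) ≥ u_min·w/(4 + κ₁)` (only `κ₀`, `κ₁ < Dt_min` enter: C¹ data);
* **`normalAngleFn_expand_of_hessFloor`** — (H) at every angle ⇒ `(u_min·w/(4 + κ₁))·|θ − θ′| ≤ |α(θ) − α(θ′)|` (the `BandBounds.gauss` field on the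
  moving curve, frame-uniform constant).
What is NOT here (T+, bridge): the coordinate form `hessQuad (frameLevel μ K) (toLp p) (toLp v) = 2cos p₀·v₀² + 2cos p₁·v₁² + D²δ_K(p)[v,v]`
(`δ_K = frameShift K ∘ toLp`; first-order twin landed: c4a's `fderiv_frameLevel_levelPoint_dir`), which discharges (H) from `FrameOK` (i).
Everything is PROVED; no definitions, no named facts; nothing asserts any stub or superconductivity.
References: BGM 2003 §1.2 (2.8a), §7.1 (A1.9)–(A1.10) [cite: BenfattoGiulianiMastropietro2003]; FST II Lemma 2.1 [cite: FeldmanSalmhoferTrubowitz1998].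
-/

noncomputable section

namespace Summit.HubbardSuperconductivity.HubbardSuperconductivity.Theorems.PerturbedFermiCurve

set_option linter.dupNamespace false -- summit = problem name (single-conjunct summit), D-0017

open Real Set
open Literature.MathematicalPhysics.QuantumLattice Literature.MathematicalPhysics.QuantumLattice.BandSectorCounting

section Root

variable {a b : ℝ} (B : BandBounds a b) {δ : (Fin 2 → ℝ) → ℝ} (hδs : ContDiff ℝ 2 δ)
  {κ₀ κ₁ μ : ℝ} (hδ : ∀ k : Fin 2 → ℝ, (∀ i, |k i| ≤ π) → |δ k| ≤ κ₀) (hlo : a ≤ μ - κ₀) (hhi : μ + κ₀ ≤ b)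
  (hκ : ∀ k : Fin 2 → ℝ, (∀ i, |k i| ≤ π) → ‖fderiv ℝ δ k‖ ≤ κ₁) (hκ₁ : κ₁ < B.Dtmin)
  {u : ℝ → ℝ} (hu : ∀ θ, IsBandFermiRadius (μ - δ (u θ • dir θ)) θ (u θ))
include B hδs hδ hlo hhi hκ hκ₁ hu

/-- **Curvature numerator from a tangential-Hessian floor**: if `w·(X_E′² + Y_E′²) ≤ vᵀD²E v` at `θ` then
`u·w·(u′² + u²)/(4 + κ₁) ≤ u² + 2u′² − u·u″` (p4's identity `(∇E·dir θ)·N = u·vᵀD²Ev` with `0 < ∇E·dir θ ≤ 4 + κ₁`).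
[cite: BenfattoGiulianiMastropietro2003, §7.1 (A1.7)] -/
theorem curvatureNumerator_ge_of_hessFloor {w : ℝ} (hw : 0 ≤ w) (θ : ℝ)
    (hH : w * (VXE u θ ^ 2 + VYE u θ ^ 2) ≤
      2 * Real.cos (XE u θ) * VXE u θ ^ 2 + 2 * Real.cos (YE u θ) * VYE u θ ^ 2 +
        fderiv ℝ (fderiv ℝ δ) (u θ • dir θ) ![VXE u θ, VYE u θ] ![VXE u θ, VYE u θ]) :
    u θ * w * (deriv u θ ^ 2 + u θ ^ 2) / (4 + κ₁) ≤ u θ ^ 2 + 2 * deriv u θ ^ 2 - u θ * deriv (deriv u) θ := by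
  have hsq := abs_apply_le_pi_of_isBandFermiRadius (hu θ)
  have hid := pertDt_mul_curvatureNumerator_eq B hδs hδ hlo hhi hκ hκ₁ hu θ
  have hα := pertDt_pos B hδ hlo hhi hκ hκ₁ hu θ
  set α := rayDispersionDt θ (u θ) + fderiv ℝ δ (u θ • dir θ) (dir θ) with hαdef
  set N := u θ ^ 2 + 2 * deriv u θ ^ 2 - u θ * deriv (deriv u) θ with hN
  set H := 2 * Real.cos (XE u θ) * VXE u θ ^ 2 + 2 * Real.cos (YE u θ) * VYE u θ ^ 2 +
        fderiv ℝ (fderiv ℝ δ) (u θ • dir θ) ![VXE u θ, VYE u θ] ![VXE u θ, VYE u θ] with hHdef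
  have hupos : 0 < u θ := (mem_Ioo_of_shifted B hδ hlo hhi (hu θ)).1
  have hα4 : α ≤ 4 + κ₁ := by
    have h1 := (abs_le.1 (abs_rayDispersionDt_le_four θ (u θ))).2
    have h2 := (abs_le.1 (abs_fderiv_dir_le (hκ _ hsq) θ)).2
    linarith
  have h4 : 0 < 4 + κ₁ := hα.trans_le hα4
  -- `u·w·S ≤ u·H = α·N`
  have hS : deriv u θ ^ 2 + u θ ^ 2 = VXE u θ ^ 2 + VYE u θ ^ 2 := deriv_sq_add_sq_eq_VXE u θ
  have hlow : u θ * w * (deriv u θ ^ 2 + u θ ^ 2) ≤ α * N := by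
    rw [hid, hS]
    have := mul_le_mul_of_nonneg_left hH hupos.le
    linarith
  have hN0 : 0 ≤ N := by
    have h0 : 0 ≤ u θ * w * (deriv u θ ^ 2 + u θ ^ 2) := by positivity
    nlinarith
  rw [div_le_iff₀ h4]
  calc u θ * w * (deriv u θ ^ 2 + u θ ^ 2) ≤ α * N := hlow
    _ ≤ (4 + κ₁) * N := mul_le_mul_of_nonneg_right hα4 hN0
    _ = N * (4 + κ₁) := mul_comm _ _

/-- **Gauss-map rate from a tangential-Hessian floor**: `α′(θ) ≥ u_min·w/(4 + κ₁)` — `κ₂`-free, hence uniform over the frames of `TwoShellFrameAreaAt`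
once (H) is read from `FrameOK` (i). [cite: BenfattoGiulianiMastropietro2003, §7.1 (A1.10)] -/
theorem deriv_normalAngleFn_ge_of_hessFloor {w : ℝ} (hw : 0 ≤ w) (θ : ℝ)
    (hH : w * (VXE u θ ^ 2 + VYE u θ ^ 2) ≤
      2 * Real.cos (XE u θ) * VXE u θ ^ 2 + 2 * Real.cos (YE u θ) * VYE u θ ^ 2 +
        fderiv ℝ (fderiv ℝ δ) (u θ • dir θ) ![VXE u θ, VYE u θ] ![VXE u θ, VYE u θ]) :
    B.umin * w / (4 + κ₁) ≤ deriv (fun ϑ => ϑ - Real.arctan (deriv u ϑ / u ϑ)) θ := by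
  have hsq := abs_apply_le_pi_of_isBandFermiRadius (hu θ)
  have hκ₁0 : 0 ≤ κ₁ := le_trans (norm_nonneg _) (hκ _ hsq)
  have h4 : 0 < 4 + κ₁ := by linarith
  have hupos : 0 < u θ := (mem_Ioo_of_shifted B hδ hlo hhi (hu θ)).1
  have humin : B.umin ≤ u θ := umin_le_of_shifted B hδ hlo hhi (hu θ)
  have hN := curvatureNumerator_ge_of_hessFloor B hδs hδ hlo hhi hκ hκ₁ hu hw θ hH
  rw [deriv_normalAngleFn_eq B hδs hδ hlo hhi hκ hκ₁ hu θ]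
  have hD : 0 < u θ ^ 2 + deriv u θ ^ 2 := by positivity
  rw [le_div_iff₀ hD]
  have e : B.umin * w / (4 + κ₁) * (u θ ^ 2 + deriv u θ ^ 2) ≤ u θ * w * (deriv u θ ^ 2 + u θ ^ 2) / (4 + κ₁) := by
    rw [div_mul_eq_mul_div]
    refine div_le_div_of_nonneg_right ?_ h4.le
    have : B.umin * w * (u θ ^ 2 + deriv u θ ^ 2) ≤ u θ * w * (u θ ^ 2 + deriv u θ ^ 2) :=
      mul_le_mul_of_nonneg_right (mul_le_mul_of_nonneg_right humin hw) hD.le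
    linarith
  exact e.trans hN

/-- **Expanding Gauss map from a tangential-Hessian floor at every angle**: `(u_min·w/(4 + κ₁))·|θ − θ′| ≤ |α(θ) − α(θ′)|` — the `BandBounds.gauss`
field on the moving curve with a frame-uniform constant. [cite: BenfattoGiulianiMastropietro2003, §7.1 Lemma 7.1 (A1.9)] -/
theorem normalAngleFn_expand_of_hessFloor {w : ℝ} (hw : 0 ≤ w)
    (hH : ∀ θ, w * (VXE u θ ^ 2 + VYE u θ ^ 2) ≤
      2 * Real.cos (XE u θ) * VXE u θ ^ 2 + 2 * Real.cos (YE u θ) * VYE u θ ^ 2 +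
        fderiv ℝ (fderiv ℝ δ) (u θ • dir θ) ![VXE u θ, VYE u θ] ![VXE u θ, VYE u θ]) (θ θ' : ℝ) :
    B.umin * w / (4 + κ₁) * |θ - θ'| ≤ |(θ - Real.arctan (deriv u θ / u θ)) - (θ' - Real.arctan (deriv u θ' / u θ'))| :=
  normalAngleFn_expand_of_le_deriv B hδs hδ hlo hhi hκ hκ₁ hu
    (fun z => deriv_normalAngleFn_ge_of_hessFloor B hδs hδ hlo hhi hκ hκ₁ hu hw z (hH z)) θ θ'

/-- Oriented form: `(u_min·w/(4 + κ₁))·(θ′ − θ) ≤ α(θ′) − α(θ)` for `θ ≤ θ′` — the normal angle is strictly increasing at a frame-uniform rate.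
[cite: BenfattoGiulianiMastropietro2003, §7.1 Lemma 7.1 (A1.9)] -/
theorem normalAngleFn_sub_ge_of_hessFloor {w : ℝ} (hw : 0 ≤ w)
    (hH : ∀ θ, w * (VXE u θ ^ 2 + VYE u θ ^ 2) ≤
      2 * Real.cos (XE u θ) * VXE u θ ^ 2 + 2 * Real.cos (YE u θ) * VYE u θ ^ 2 +
        fderiv ℝ (fderiv ℝ δ) (u θ • dir θ) ![VXE u θ, VYE u θ] ![VXE u θ, VYE u θ]) {θ θ' : ℝ} (hθ : θ ≤ θ') :
    B.umin * w / (4 + κ₁) * (θ' - θ) ≤ (θ' - Real.arctan (deriv u θ' / u θ')) - (θ - Real.arctan (deriv u θ / u θ)) :=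
  normalAngleFn_sub_ge_of_le_deriv B hδs hδ hlo hhi hκ hκ₁ hu
    (fun z => deriv_normalAngleFn_ge_of_hessFloor B hδs hδ hlo hhi hκ hκ₁ hu hw z (hH z)) hθ

end Root

end Summit.HubbardSuperconductivity.HubbardSuperconductivity.Theorems.PerturbedFermiCurve

end
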